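import Literature.Geometry.Lorentzian.DiagonalChartMetric
import HarnessLib

/-!
# Flat regions of diagonal chart metrics: the Milne-type components `(−1, 1, t², 1)`

Support file (everything proved, no named facts) for the explicit vacuum spacetime of
`Literature.Geometry.Lorentzian.christodoulou_trapped_surface_formation_holds`.

If the components of a diagonal chart metric `g` (`OpensChart.diagLorentz`) agree on an open set
`U ⊆ V` with `(−1, 1, (y⁰)², 1)` — the flat metric `−dt² + dθ² + t² dξ² + dζ²` (Minkowski space in
the Milne-type coordinates `T = t cosh ξ`, `X = t sinh ξ` of the `(t, ξ)`-plane; this is the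
polarized Gowdy metric with `P = log t`, `λ = log t`) — then the Riemann tensor of `g` vanishes on
`U` (`OpensChart.riemann_eq_zero_of_flatRegion`). The proof is the coordinate computation of
O'Neill 1983, Ch. 3, Lemma 3.38 via `MetricCoord.apply_riemAt_diagMetric_eb`: the only
non-vanishing derivatives are `∂ₜ g₂ = 2t`, `∂ₜ∂ₜ g₂ = 2`, and the `4⁴` first-kind components
`½(∂∂g) − ¼ g⁻¹(∂g)(∂g)` cancel (`Γ⁰₂₂ = t`, `Γ²₀₂ = 1/t`, `R⁰₂₀₂ = ∂ₜΓ⁰₂₂ − Γ⁰₂₂Γ²₀₂ = 1 − 1 = 0`;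
`OpensChart.flat_core`).

## References

* B. O'Neill, *Semi-Riemannian geometry*, Academic Press 1983, Ch. 3, Lemma 3.38. [ONeill1983]
-/

noncomputable section

open Set Filter TopologicalSpace
open scoped Topology ContDiff Manifold

namespace Literature.Geometry.Lorentzian

namespace OpensChart

open MetricCoord

/-- The flat Milne-type component values `(−1, 1, t², 1)`. [cite: ONeill1983, Ch. 3, Lemma 3.38] -/
def flatVal (t : ℝ) : Fin 4 → ℝ := ![-1, 1, t ^ 2, 1]

/-- The flat Milne-type components `(−1, 1, (y⁰)², 1)` as functions on `E4`.
[cite: ONeill1983, Ch. 3, Lemma 3.38] -/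
def flatComp (i : Fin 4) (y : E4) : ℝ := flatVal (y 0) i

/-- Table of first derivatives of the flat components: `∂_{a'} gᵢ = 2t` for `(i, a') = (2, 0)`,
else `0`. [folklore] -/
def flatD1 (t : ℝ) (i a' : Fin 4) : ℝ := if i = 2 ∧ a' = 0 then 2 * t else 0

/-- Table of second derivatives of the flat components: `∂_a ∂_{b'} gᵢ = 2` for
`(a, i, b') = (0, 2, 0)`, else `0`. [folklore] -/
def flatD2 (a i b' : Fin 4) : ℝ := if a = 0 ∧ i = 2 ∧ b' = 0 then 2 else 0

set_option maxHeartbeats 2000000 in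
/-- **The algebraic core**: with the tables `flatD1`, `flatD2` and the values `flatVal`, all `4⁴`
first-kind curvature components of `MetricCoord.apply_riemAt_diagMetric_eb` vanish (`t ≠ 0`).
[cite: ONeill1983, Ch. 3, Lemma 3.38] -/
theorem flat_core {t : ℝ} (ht : t ≠ 0) (a b c e : Fin 4) :
    2⁻¹ * (kd (fun i b' ↦ flatD2 a i b') b c e - kd (fun i b' ↦ flatD2 b i b') a c e)
      - ∑ m, kd (flatD1 t) b c m * kd (flatD1 t) a e m / (4 * flatVal t m)
      + ∑ m, kd (flatD1 t) a c m * kd (flatD1 t) b e m / (4 * flatVal t m) = 0 := by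
  fin_cases a <;> fin_cases b <;> fin_cases c <;> fin_cases e <;>
    simp [kd, flatD1, flatD2, flatVal, Fin.sum_univ_four] <;> field_simp <;> ring

/-- The derivative of `y ↦ (y⁰)²` is `2 y⁰ dy⁰`. [folklore] -/
theorem hasFDerivAt_sq_coord (y : E4) :
    HasFDerivAt (fun z : E4 ↦ z 0 ^ 2) ((2 * y 0) • (EuclideanSpace.proj (0 : Fin 4) : E4 →L[ℝ] ℝ)) y := by
  have h1 := (EuclideanSpace.proj (0 : Fin 4) : E4 →L[ℝ] ℝ).hasFDerivAt (x := y)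
  have h2 := h1.pow 2
  refine h2.congr_fderiv ?_
  norm_num

/-- First derivatives of the flat components on coordinate vectors. [folklore] -/
theorem fderiv_flatComp_eb (i a' : Fin 4) (y : E4) :
    fderiv ℝ (flatComp i) y (eb a') = flatD1 (y 0) i a' := by
  by_cases hi : i = 2
  · subst hi
    have hfun : flatComp 2 = fun z : E4 ↦ z 0 ^ 2 := by funext z; simp [flatComp, flatVal]
    rw [hfun, (hasFDerivAt_sq_coord y).fderiv, FunLike.coe_smul, Pi.smul_apply, smul_eq_mul]
    simp only [flatD1, true_and]
    change 2 * y 0 * (eb a' : E4) 0 = _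
    rw [eb_apply]
    by_cases ha : a' = 0
    · subst ha; simp
    · simp [ha, Ne.symm ha]
  · have hfun : flatComp i = fun _ : E4 ↦ flatVal 0 i := by
      funext z
      fin_cases i <;> simp [flatComp, flatVal] at hi ⊢
    rw [hfun]
    simp [flatD1, hi]

variable {V : Opens E4} {g : Fin 4 → E4 → ℝ} {hg : ∀ i, ContDiffOn ℝ ∞ (g i) V}
  {h0 : ∀ y ∈ (V : Set E4), g 0 y < 0} {hpos : ∀ i : Fin 3, ∀ y ∈ (V : Set E4), 0 < g i.succ y}
  {U : Set E4}

/-- On the flat region the first derivatives of the components are `flatD1`. [folklore] -/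
theorem fderiv_comp_eb_of_flatRegion (hU : IsOpen U) (hflat : ∀ i, ∀ y ∈ U, g i y = flatComp i y)
    (i a' : Fin 4) {y : E4} (hy : y ∈ U) : fderiv ℝ (g i) y (eb a') = flatD1 (y 0) i a' := by
  have heq : g i =ᶠ[𝓝 y] flatComp i := by
    filter_upwards [hU.mem_nhds hy] with z hz using hflat i z hz
  rw [heq.fderiv_eq, fderiv_flatComp_eb]

/-- On the flat region the second derivatives of the components are `flatD2`. [folklore] -/
theorem fderiv_fderiv_comp_eb_of_flatRegion (hU : IsOpen U)
    (hflat : ∀ i, ∀ y ∈ U, g i y = flatComp i y) (a i b' : Fin 4) {y : E4} (hy : y ∈ U) :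
    fderiv ℝ (fun z ↦ fderiv ℝ (g i) z (eb b')) y (eb a) = flatD2 a i b' := by
  have heq : (fun z ↦ fderiv ℝ (g i) z (eb b')) =ᶠ[𝓝 y] fun z ↦ flatD1 (z 0) i b' := by
    filter_upwards [hU.mem_nhds hy] with z hz using fderiv_comp_eb_of_flatRegion hU hflat i b' hz
  rw [heq.fderiv_eq]
  by_cases hib : i = 2 ∧ b' = 0
  · obtain ⟨rfl, rfl⟩ := hib
    have hfun : (fun z : E4 ↦ flatD1 (z 0) 2 0) = fun z : E4 ↦ 2 * z 0 := by
      funext z; simp [flatD1]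
    have h : HasFDerivAt (fun z : E4 ↦ 2 * z 0)
        ((2 : ℝ) • (EuclideanSpace.proj (0 : Fin 4) : E4 →L[ℝ] ℝ)) y :=
      ((EuclideanSpace.proj (0 : Fin 4) : E4 →L[ℝ] ℝ).hasFDerivAt (x := y)).const_mul 2
    rw [hfun, h.fderiv, FunLike.coe_smul, Pi.smul_apply, smul_eq_mul]
    simp only [flatD2, true_and]
    change 2 * (eb a : E4) 0 = _
    rw [eb_apply]
    by_cases ha : a = 0
    · subst ha; simp
    · simp [ha, Ne.symm ha]
  · have hfun : (fun z : E4 ↦ flatD1 (z 0) i b') = fun _ ↦ (0 : ℝ) := by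
      funext z; simp [flatD1, hib]
    rw [hfun]
    simp only [fderiv_fun_const, Pi.zero_apply, _root_.zero_apply, flatD2]
    rw [if_neg (fun h ↦ hib h.2)]

/-- **The Riemann tensor vanishes on a flat Milne-type region**: if the components of the diagonal
chart metric agree with `(−1, 1, (y⁰)², 1)` on an open `U ⊆ V`, then `Riem(y) = 0` for `y ∈ U`
(O'Neill 1983, Ch. 3, Lemma 3.38 and `flat_core`). [cite: ONeill1983, Ch. 3, Lemma 3.38] -/
theorem riemann_eq_zero_of_flatRegion
    [(diagLorentz V g hg h0 hpos).toPseudoRiemannianMetric.HasLeviCivita] (hU : IsOpen U)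
    (hUV : U ⊆ (V : Set E4)) (hflat : ∀ i, ∀ y ∈ U, g i y = flatComp i y) (y : V) (hy : y.1 ∈ U) :
    (diagLorentz V g hg h0 hpos).toPseudoRiemannianMetric.riemann y = 0 := by
  refine riemann_diagLorentz_eq_zero_of_eb y fun a b c e ↦ ?_
  have hne : ∀ i, ∀ z ∈ U, g i z ≠ 0 := fun i z hz ↦ diag_ne_zero h0 hpos i z (hUV hz)
  rw [apply_riemAt_diagMetric_eb hU (fun i ↦ (hg i).mono hUV) hne hy]
  have ht : y.1 0 ≠ 0 := by
    have h2 := hne 2 y.1 hy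
    rw [hflat 2 y.1 hy] at h2
    simpa [flatComp, flatVal] using h2
  have hg' : ∀ m, g m y.1 = flatVal (y.1 0) m := fun m ↦ hflat m y.1 hy
  simp only [fderiv_comp_eb_of_flatRegion hU hflat _ _ hy,
    fderiv_fderiv_comp_eb_of_flatRegion hU hflat _ _ _ hy, hg']
  exact flat_core ht a b c e

end OpensChart

end Literature.Geometry.Lorentzian
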